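import Literature.AlgebraicGeometry.HodgeTheory.BettiSelfProductExceptionalHodgeClasses
import Literature.AlgebraicGeometry.HodgeTheory.AbelianVarietyHOneHodgeHomSpaces
import Literature.AlgebraicGeometry.HodgeTheory.BettiAbelianVarietyPicardNumberBound
import Literature.AlgebraicGeometry.Motives.HodgeStructurePolarizationTransposeHom
import Literature.AlgebraicGeometry.Motives.HodgeTensorFactsHolds
import HarnessLib

/-!
# Riemann's theorem on the lane's carriers: `dim_ℚ Hom_HS(H¹(A), H¹(A')) = rk_ℤ Hom(A', A)`, the Picard number of a product of abelian varieties
# `ρ(A × A') = ρ(A) + ρ(A') + rk Hom(A', A)`, `ρ(A × A) = 2ρ(A) + rk End(A)`, and the Hodge bounds `rk Hom(A, A') ≤ 2gg'`, `rk Hom(A, A') = rk Hom(A', A)`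
# (Deligne–Milne Thm. 6.20 (Riemann); Hulek–Laface Prop. 2.2 / Cor. 2.3; Murty; Lange 2023 Prop. 1.1.8; Voisin I Lemma 11.41)

Family `hodge`, lane `lit-hodgefound` (Track 2 foundations library; Layers A1/A2/A4), layer `Literature/AlgebraicGeometry/HodgeTheory`.  THEOREMS ONLY (no definition,
no named fact, no instance; D-0026 net debt `0`).  Junction of the seat's product files with Layer A1's abelian-variety records (gen-27 HANDOFF free pointers (d)/(e)): g27-#7
(`BettiKunnethHodgeClassesHodgeMorphisms`) proved `ρ(Y × Z) = ρ(Y) + ρ(Z) + dim_ℚ Hom_HS(H¹(Y), H¹(Z))` and `dim_ℚ Hom_HS(H¹(Y), H¹(Z)) ≤ 2 q(Y) q(Z)` on the lane's carriers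
`H¹(X) = BettiUniverse.hodge hHD hX 1`; g28-#2 (`BettiSelfProductExceptionalHodgeClasses`) `ρ(X × X) = 2ρ(X) + dim_ℚ End_HS(H¹(X))`; Layer A1 (`AbelianVarietyHOneHodgeHomSpaces`, Riemann's theorem
= Deligne–Milne Thm. 6.20 numerically) proved `dim_ℚ Hom_{Hod}(H¹_B(A'), H¹_B(A)) = rk_ℤ Hom(A, A')` on the RECORD avatar `bettiOneHodgeStructure A B hB`, and
`BettiOneHodgeStructureModelIndependence` that the record avatar IS the lane's `H¹` up to the weight label.  This file composes them: on the lane's carriers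
**`dim_ℚ Hom_HS(H¹(A), H¹(A')) = rk_ℤ Hom(A', A)`**, whence the classical **`ρ(A × A') = ρ(A) + ρ(A') + rk_ℤ Hom(A', A)`** («`NS(A₁ × A₂) = NS(A₁) ⊕ NS(A₂) ⊕ Hom(A₁, A₂)`»), **`ρ(A × A) =
2ρ(A) + rk_ℤ End(A)`** (Murty / Hulek–Laface Cor. 2.3), and — from the Hodge-theoretic bound — **`rk_ℤ Hom(A, A') ≤ 2 dim A · dim A'`** (Lange's Prop. 1.1.8 prints `≤ 4gg'` from the rational
representation; the analytic/Hodge bound halves it, sharp for powers of a CM elliptic curve) together with the symmetry **`rk_ℤ Hom(A, A') = rk_ℤ Hom(A', A)`** (transposes).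

THE PRINTS.  P. Deligne, J. S. Milne (1982) [DeligneMilne1982Tannakian] II §6 Thm. 6.20 («(Riemann) The functor `H_B^1 : Isab_ℂ → Hod_ℚ` is fully faithful»).  K. Hulek, R. Laface (2019)
[HulekLaface2019PicardNumbersAV] §2.1 Prop. 2.2 («`NS(A₁ × A₂) ≅ NS(A₁) ⊕ NS(A₂) ⊕ Hom(A₁, A₂)`»), Cor. 2.3 (`ρ(A × A) = 2ρ(A) + rk End(A)`, after Murty).  H. Lange (2023)
[Lange2023AbelianVarietiesComplex] §1.1.2 Prop. 1.1.8 («`Hom(X, X') ≃ ℤ^m` for some `m ≤ 4gg'`»), §1.1.5 Thm. 1.1.21 (b) (`q(A) = g`), §1.4.1 and §2.4.1 (dual homomorphism, transposes).  C. Voisin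
(2002) [VoisinHodgeI2002] §11.3.3 Lemma 11.41 (p. 286), p. 287.  D. Arapura (2012) [Arapura2012] §11.2 (PDF p. 177) (`ρ(A) ≤ g²`).

THE OBJECTS (all the tree's).  `A A' : Motives.AbelianVariety ℂ` with underlying `A.X : SchemeOver ℂ` of dimension `A.dim`, `hA : IsSmoothProjective A.dim A.X` (any witness; one is
`AbelianVariety.isSmoothProjective_holds`); `A ⟶ A'` the `ℤ`-module of homomorphisms (free of finite rank: `module_free_hom_holds`, `module_finite_hom_holds`), `rk_ℤ Hom(A, A') =
Module.finrank ℤ (A ⟶ A')`; `H¹(A) = BettiUniverse.hodge hHD hA 1`, `ρ(A) = dim_ℚ Hdg¹(H²(A.X))`, `g = A.dim = q(A)`.  No `[HodgeTensorFacts]` hypothesis: Deligne's tensor-filtration facts are the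
tree's theorem `hodgeTensorFacts_holds` and are supplied inside the proofs.

WHAT IS PROVED.
* §1 RIEMANN ON THE CARRIERS: **`dim_ℚ Hom_HS(H¹(A), H¹(A')) = rk_ℤ Hom(A', A)`** (`BettiUniverse.finrank_hom_hodge_one_abelianVariety_eq`; any witnesses `hA`, `hA'`), `dim_ℚ End_HS(H¹(A)) = rk_ℤ End(A)`
  (`…_self_eq`).
* §2 RANKS OF `Hom(A, A')`: **`rk_ℤ Hom(A, A') = rk_ℤ Hom(A', A)`** (`AbelianVariety.finrank_hom_eq_finrank_hom_swap`: transposition for the polarizations of `H¹`, Thm. 6.32 / Lange §2.4.1),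
  **`rk_ℤ Hom(A, A') ≤ 2 · dim A · dim A'`** (`AbelianVariety.finrank_hom_le_two_mul_dim_mul_dim`; `Hom_HS(H¹A', H¹A) ⊗ ℂ ⊆ Hom(H^{1,0}, H^{1,0}) ⊕ Hom(H^{0,1}, H^{0,1})`), `rk_ℤ End(A) ≤ 2(dim A)²`
  (`1 ≤ rk_ℤ End(A)` for `dim A ≥ 1` is the tree's `Motives.AbelianVariety.finrank_end_pos`).
* §3 PICARD NUMBERS: **`ρ(A × A') = ρ(A) + ρ(A') + rk_ℤ Hom(A', A)`** (`BettiUniverse.picardNumber_tensor_abelianVarieties`; any smooth-projective structure on `A.X ⊗ A'.X`), **`ρ(A × A) = 2ρ(A) +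
  rk_ℤ End(A)`** (`BettiUniverse.picardNumber_tensor_abelianVariety_self`), `ρ(A × A') = ρ(A) + ρ(A')` iff `rk Hom(A', A) = 0`, the bounds `ρ(A × A') ≤ ρ(A) + ρ(A') + 2gg' ≤ (g + g')²` and
  `3 ≤ ρ(A × A)` for `dim A ≥ 1` (`2ρ(A) + 1 ≤ ρ(A × A)`).

DEVIATIONS / SCOPE.  Jacobians (`ρ(C × C') = 2 + rk Hom(J(C), J(C'))`) are not treated (no `H¹(C) ≅ H¹(J(C))` is used here); the isomorphism `NS(A × A') ≅ NS(A) ⊕ NS(A') ⊕ Hom(A, A')` itself is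
by dimension count only.

## References
* [DeligneMilne1982Tannakian] P. Deligne, J. S. Milne, *Tannakian Categories*, LNM 900 (1982) — II §6 Thm. 6.20 (p. 212).
* [HulekLaface2019PicardNumbersAV] K. Hulek, R. Laface, *On the Picard numbers of abelian varieties*, Ann. Sc. Norm. Super. Pisa (2019) — §2.1 Prop. 2.2, Cor. 2.3.
* [Lange2023AbelianVarietiesComplex] H. Lange, *Abelian Varieties over the Complex Numbers* (2023) — §1.1.2 Prop. 1.1.8 (PDF p. 20); §1.1.5 Thm. 1.1.21 (b); §1.4.1; §2.4.1 Lemma 2.4.1.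
* [VoisinHodgeI2002] C. Voisin, *Hodge Theory and Complex Algebraic Geometry I* (2002) — §11.3.3 Lemma 11.41 (p. 286), p. 287; §7.1.2 Thm. 6.32.
* [Arapura2012] D. Arapura, *Algebraic Geometry over the Complex Numbers* (2012) — §11.2 (PDF p. 177).

## Provenance
Lane `lit-hodgefound` (Hodge path, Track 2), prover seat `lit-hodgefound-p29` (generation 28), self-proposed row g28-#5 (gen-27 HANDOFF free pointers (d)/(e); junction of g27-#7 / g28-#2 with
Layer A1's `AbelianVarietyHOneHodgeHomSpaces` and `BettiOneHodgeStructureModelIndependence`).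
-/

noncomputable section

open scoped TensorProduct
open CategoryTheory MonoidalCategory Module Finset
open Literature.AlgebraicTopology.SingularHomology
open Literature.Geometry.Kaehler

namespace Literature.AlgebraicGeometry.HodgeTheory

open Literature.AlgebraicGeometry.Motives
open Literature.AlgebraicGeometry.Motives.HodgeStructure

/-! ### §0 Plumbing: relabelling the weight on both sides of a morphism space -/

section Plumbing

universe u

variable {V : Type u} [AddCommGroup V] [Module ℚ V] {W : Type u} [AddCommGroup W] [Module ℚ W] {w w' : ℤ}

/-- `Hom_HS(H₁, H₂) ≅ Hom_HS(H₁.cast h, H₂.cast h)` (same linear maps, same filtrations), in dimensions. [folklore] -/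
private theorem finrank_hom_cast_cast (H₁ : HodgeStructure V w) (H₂ : HodgeStructure W w) (h : w = w') :
    Module.finrank ℚ (HodgeStructure.Hom (H₁.cast h) (H₂.cast h)) = Module.finrank ℚ (HodgeStructure.Hom H₁ H₂) :=
  LinearEquiv.finrank_eq
    { toFun := fun g ↦ ⟨g.toLinearMap, g.map_F_le⟩
      invFun := fun f ↦ ⟨f.toLinearMap, f.map_F_le⟩
      map_add' := fun _ _ ↦ HodgeStructure.Hom.ext rfl
      map_smul' := fun _ _ ↦ HodgeStructure.Hom.ext rfl
      left_inv := fun _ ↦ HodgeStructure.Hom.ext rfl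
      right_inv := fun _ ↦ HodgeStructure.Hom.ext rfl }

end Plumbing

/-! ### §1 Riemann's theorem on the lane's carriers -/

section Riemann

variable (A A' : Motives.AbelianVariety ℂ)

/-- **`dim_ℚ Hom_HS(H¹(A), H¹(A')) = rk_ℤ Hom(A', A)`** for complex abelian varieties, on the lane's carriers `H¹(A) = BettiUniverse.hodge hHD hA 1` (any smooth-projective witnesses): the lane's
`H¹` is the record avatar `H¹_B` (`BettiUniverse.hodge_one_eq_cast_bettiOneHodgeStructure`), for which `u ↦ u^*` carries `ℤ`-bases of `Hom(A', A)` to `ℚ`-bases of `Hom_{Hod}(H¹_B(A), H¹_B(A'))`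
(Riemann's theorem, the tree's `AbelianVariety.finrank_hom_bettiOne_eq`). [cite: DeligneMilne1982Tannakian, II §6 Thm. 6.20 (Riemann), p. 212] [cite: Lange2023AbelianVarietiesComplex, §1.1.2 Prop. 1.1.8 (PDF p. 20)] -/
theorem BettiUniverse.finrank_hom_hodge_one_abelianVariety_eq (hHD : exists_isReal_hodgeModel) (hA : IsSmoothProjective A.dim A.X) (hA' : IsSmoothProjective A'.dim A'.X) :
    Module.finrank ℚ (HodgeStructure.Hom (BettiUniverse.hodge hHD hA 1) (BettiUniverse.hodge hHD hA' 1)) = Module.finrank ℤ (A' ⟶ A) := by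
  rw [BettiUniverse.hodge_one_eq_cast_bettiOneHodgeStructure hHD hodgePQ_independent_of_hodgeModel_holds A hA (BettiUniverse.realHodgeModel hHD hA)
      (BettiUniverse.realHodgeModel_isHodgeSymmetric hHD hA),
    BettiUniverse.hodge_one_eq_cast_bettiOneHodgeStructure hHD hodgePQ_independent_of_hodgeModel_holds A' hA' (BettiUniverse.realHodgeModel hHD hA')
      (BettiUniverse.realHodgeModel_isHodgeSymmetric hHD hA'),
    finrank_hom_cast_cast]
  exact AbelianVariety.finrank_hom_bettiOne_eq (BettiUniverse.realHodgeModel hHD hA') (BettiUniverse.realHodgeModel_isHodgeSymmetric hHD hA') (BettiUniverse.realHodgeModel hHD hA)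
    (BettiUniverse.realHodgeModel_isHodgeSymmetric hHD hA)

/-- **`dim_ℚ End_HS(H¹(A)) = rk_ℤ End(A)`.** [cite: DeligneMilne1982Tannakian, II §6 Thm. 6.20 (Riemann), p. 212] -/
theorem BettiUniverse.finrank_hom_hodge_one_abelianVariety_self_eq (hHD : exists_isReal_hodgeModel) (hA : IsSmoothProjective A.dim A.X) :
    Module.finrank ℚ (HodgeStructure.Hom (BettiUniverse.hodge hHD hA 1) (BettiUniverse.hodge hHD hA 1)) = Module.finrank ℤ (A ⟶ A) :=
  BettiUniverse.finrank_hom_hodge_one_abelianVariety_eq A A hHD hA hA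

/-! ### §2 The ranks of `Hom(A, A')` -/

/-- **`rk_ℤ Hom(A, A') = rk_ℤ Hom(A', A)`** (both are `dim_ℚ Hom_HS` between the polarized weight-one structures `H¹(A')`, `H¹(A)`, which transposition exchanges).
[cite: Lange2023AbelianVarietiesComplex, §1.4.1 and §2.4.1 Lemma 2.4.1] [cite: DeligneMilne1982Tannakian, II §6 Thm. 6.20 (Riemann), p. 212] -/
theorem AbelianVariety.finrank_hom_eq_finrank_hom_swap : Module.finrank ℤ (A ⟶ A') = Module.finrank ℤ (A' ⟶ A) := by
  have hHD := exists_isReal_hodgeModel_holds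
  have hA : IsSmoothProjective A.dim A.X := Motives.AbelianVariety.isSmoothProjective_holds
  have hA' : IsSmoothProjective A'.dim A'.X := Motives.AbelianVariety.isSmoothProjective_holds
  haveI := BettiUniverse.finite hA 1
  haveI := BettiUniverse.finite hA' 1
  obtain ⟨Q⟩ := BettiUniverse.hodge_isPolarizable hHD hA 1
  obtain ⟨Q'⟩ := BettiUniverse.hodge_isPolarizable hHD hA' 1
  rw [← BettiUniverse.finrank_hom_hodge_one_abelianVariety_eq A' A hHD hA' hA, ← BettiUniverse.finrank_hom_hodge_one_abelianVariety_eq A A' hHD hA hA']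
  exact Q'.finrank_hom_eq_finrank_hom_swap Q

/-- **`rk_ℤ Hom(A, A') ≤ 2 · dim A · dim A'`**: `Hom(A, A') ⊗ ℚ = Hom_HS(H¹(A'), H¹(A))` and a morphism of Hodge structures of weight one is a pair of maps `H^{1,0} → H^{1,0}`, `H^{0,1} → H^{0,1}` (the
tree's `BettiUniverse.finrank_hom_hodge_one_le`, with `q(A) = dim A`); this halves Prop. 1.1.8's `m ≤ 4gg'` and is attained by powers of a CM elliptic curve.
[cite: Lange2023AbelianVarietiesComplex, §1.1.2 Prop. 1.1.8 (PDF p. 20) and §1.1.5 Thm. 1.1.21 (b)] [cite: VoisinHodgeI2002, §11.3.3 Def. 11.39 and Lemma 11.41 (pp. 285–286)] -/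
theorem AbelianVariety.finrank_hom_le_two_mul_dim_mul_dim : Module.finrank ℤ (A ⟶ A') ≤ 2 * A.dim * A'.dim := by
  haveI : HodgeTensorFacts.{0, 0} := hodgeTensorFacts_holds
  have hHD := exists_isReal_hodgeModel_holds
  have hA : IsSmoothProjective A.dim A.X := Motives.AbelianVariety.isSmoothProjective_holds
  have hA' : IsSmoothProjective A'.dim A'.X := Motives.AbelianVariety.isSmoothProjective_holds
  rw [← BettiUniverse.finrank_hom_hodge_one_abelianVariety_eq A' A hHD hA' hA]
  have h := BettiUniverse.finrank_hom_hodge_one_le hHD hA' hA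
  rw [BettiUniverse.hodgeNumber_hodge_one_abelianVariety_one_zero (A := A') hHD hA', BettiUniverse.hodgeNumber_hodge_one_abelianVariety_one_zero (A := A) hHD hA] at h
  calc _ ≤ 2 * (A'.dim * A.dim) := h
    _ = 2 * A.dim * A'.dim := by ring

/-- **`rk_ℤ End(A) ≤ 2 (dim A)²`.** [cite: Lange2023AbelianVarietiesComplex, §1.1.2 Prop. 1.1.8 (PDF p. 20) and §1.1.5 Thm. 1.1.21 (b)] -/
theorem AbelianVariety.finrank_end_le_two_mul_dim_sq : Module.finrank ℤ (A ⟶ A) ≤ 2 * A.dim ^ 2 := by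
  rw [sq, ← mul_assoc]
  exact AbelianVariety.finrank_hom_le_two_mul_dim_mul_dim A A

end Riemann

/-! ### §3 Picard numbers of products of abelian varieties -/

section Picard

variable (A A' : Motives.AbelianVariety ℂ)

/-- **`ρ(A × A') = ρ(A) + ρ(A') + rk_ℤ Hom(A', A)`** («`NS(A₁ × A₂) = NS(A₁) ⊕ NS(A₂) ⊕ Hom(A₁, A₂)`», by dimensions; any smooth-projective structure on `A.X ⊗ A'.X`).
[cite: HulekLaface2019PicardNumbersAV, §2.1 Prop. 2.2] [cite: DeligneMilne1982Tannakian, II §6 Thm. 6.20 (Riemann), p. 212] [cite: VoisinHodgeI2002, §11.3.3 Lemma 11.41 (p. 286) and p. 287] -/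
theorem BettiUniverse.picardNumber_tensor_abelianVarieties (hHD : exists_isReal_hodgeModel) (hA : IsSmoothProjective A.dim A.X) (hA' : IsSmoothProjective A'.dim A'.X) {d : ℕ}
    (hAA' : IsSmoothProjective d (A.X ⊗ A'.X)) :
    Module.finrank ℚ ↥((BettiUniverse.hodge hHD hAA' 2).hodgeClasses 1) =
      Module.finrank ℚ ↥((BettiUniverse.hodge hHD hA 2).hodgeClasses 1) + Module.finrank ℚ ↥((BettiUniverse.hodge hHD hA' 2).hodgeClasses 1) + Module.finrank ℤ (A' ⟶ A) := by
  haveI : HodgeTensorFacts.{0, 0} := hodgeTensorFacts_holds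
  rw [BettiUniverse.picardNumber_tensor_eq_add_finrank_hom hHD hA hA' hAA', BettiUniverse.finrank_hom_hodge_one_abelianVariety_eq A A' hHD hA hA']

/-- **`ρ(A × A) = 2ρ(A) + rk_ℤ End(A)`** (Murty; Hulek–Laface Cor. 2.3). [cite: HulekLaface2019PicardNumbersAV, §2.1 Prop. 2.2 and Cor. 2.3] [cite: DeligneMilne1982Tannakian, II §6 Thm. 6.20 (Riemann), p. 212] -/
theorem BettiUniverse.picardNumber_tensor_abelianVariety_self (hHD : exists_isReal_hodgeModel) (hA : IsSmoothProjective A.dim A.X) {d : ℕ} (hAA : IsSmoothProjective d (A.X ⊗ A.X)) :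
    Module.finrank ℚ ↥((BettiUniverse.hodge hHD hAA 2).hodgeClasses 1) = 2 * Module.finrank ℚ ↥((BettiUniverse.hodge hHD hA 2).hodgeClasses 1) + Module.finrank ℤ (A ⟶ A) := by
  haveI : HodgeTensorFacts.{0, 0} := hodgeTensorFacts_holds
  rw [BettiUniverse.picardNumber_tensor_self_eq hHD hA hAA, BettiUniverse.finrank_hom_hodge_one_abelianVariety_self_eq A hHD hA]

/-- **`ρ(A × A') = ρ(A) + ρ(A')` iff `rk_ℤ Hom(A', A) = 0`** (no extra divisor classes iff no homomorphisms). [cite: HulekLaface2019PicardNumbersAV, §2.1 Prop. 2.2] -/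
theorem BettiUniverse.picardNumber_tensor_abelianVarieties_eq_add_iff (hHD : exists_isReal_hodgeModel) (hA : IsSmoothProjective A.dim A.X) (hA' : IsSmoothProjective A'.dim A'.X) {d : ℕ}
    (hAA' : IsSmoothProjective d (A.X ⊗ A'.X)) :
    Module.finrank ℚ ↥((BettiUniverse.hodge hHD hAA' 2).hodgeClasses 1) =
        Module.finrank ℚ ↥((BettiUniverse.hodge hHD hA 2).hodgeClasses 1) + Module.finrank ℚ ↥((BettiUniverse.hodge hHD hA' 2).hodgeClasses 1) ↔
      Module.finrank ℤ (A' ⟶ A) = 0 := by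
  rw [BettiUniverse.picardNumber_tensor_abelianVarieties A A' hHD hA hA' hAA']
  omega

/-- **`ρ(A × A') ≤ ρ(A) + ρ(A') + 2 · dim A · dim A'`.** [cite: HulekLaface2019PicardNumbersAV, §2.1 Prop. 2.2] [cite: Lange2023AbelianVarietiesComplex, §1.1.2 Prop. 1.1.8 (PDF p. 20)] -/
theorem BettiUniverse.picardNumber_tensor_abelianVarieties_le (hHD : exists_isReal_hodgeModel) (hA : IsSmoothProjective A.dim A.X) (hA' : IsSmoothProjective A'.dim A'.X) {d : ℕ}
    (hAA' : IsSmoothProjective d (A.X ⊗ A'.X)) :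
    Module.finrank ℚ ↥((BettiUniverse.hodge hHD hAA' 2).hodgeClasses 1) ≤
      Module.finrank ℚ ↥((BettiUniverse.hodge hHD hA 2).hodgeClasses 1) + Module.finrank ℚ ↥((BettiUniverse.hodge hHD hA' 2).hodgeClasses 1) + 2 * A.dim * A'.dim := by
  rw [BettiUniverse.picardNumber_tensor_abelianVarieties A A' hHD hA hA' hAA']
  have h := AbelianVariety.finrank_hom_le_two_mul_dim_mul_dim A' A
  have e : 2 * A'.dim * A.dim = 2 * A.dim * A'.dim := by ring
  omega

/-- **`ρ(A × A') ≤ (dim A + dim A')²`** (`ρ(A) ≤ g²`, `ρ(A') ≤ g'²`, `rk Hom ≤ 2gg'` — consistent with `ρ ≤ (dim)²` for the abelian variety `A × A'`). [cite: Arapura2012, §11.2 (PDF p. 177)]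
[cite: HulekLaface2019PicardNumbersAV, §2.1 Prop. 2.2] -/
theorem BettiUniverse.picardNumber_tensor_abelianVarieties_le_sq (hHD : exists_isReal_hodgeModel) (hA : IsSmoothProjective A.dim A.X) (hA' : IsSmoothProjective A'.dim A'.X) {d : ℕ}
    (hAA' : IsSmoothProjective d (A.X ⊗ A'.X)) :
    Module.finrank ℚ ↥((BettiUniverse.hodge hHD hAA' 2).hodgeClasses 1) ≤ (A.dim + A'.dim) ^ 2 := by
  have h := BettiUniverse.picardNumber_tensor_abelianVarieties_le A A' hHD hA hA' hAA'
  have h₁ := BettiUniverse.finrank_hodgeClasses_hodge_two_abelianVariety_le_sq A hHD hA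
  have h₂ := BettiUniverse.finrank_hodgeClasses_hodge_two_abelianVariety_le_sq A' hHD hA'
  calc _ ≤ A.dim ^ 2 + A'.dim ^ 2 + 2 * A.dim * A'.dim := by omega
    _ = (A.dim + A'.dim) ^ 2 := by ring

/-- **`2ρ(A) + 1 ≤ ρ(A × A)` for `dim A ≥ 1`** (the graph of the identity: `rk End(A) ≥ 1`, the tree's `finrank_end_pos`), in particular `3 ≤ ρ(A × A)`.
[cite: HulekLaface2019PicardNumbersAV, §2.1 Cor. 2.3] [cite: Arapura2012, §11.2 (PDF p. 177)] -/
theorem BettiUniverse.two_mul_picardNumber_add_one_le_tensor_abelianVariety_self (hHD : exists_isReal_hodgeModel) (hA : IsSmoothProjective A.dim A.X) {d : ℕ}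
    (hAA : IsSmoothProjective d (A.X ⊗ A.X)) (hg : 1 ≤ A.dim) :
    2 * Module.finrank ℚ ↥((BettiUniverse.hodge hHD hA 2).hodgeClasses 1) + 1 ≤ Module.finrank ℚ ↥((BettiUniverse.hodge hHD hAA 2).hodgeClasses 1) := by
  rw [BettiUniverse.picardNumber_tensor_abelianVariety_self A hHD hA hAA]
  have h := Motives.AbelianVariety.finrank_end_pos (B := A) hg
  omega

/-- **`3 ≤ ρ(A × A)` for `dim A ≥ 1`** (the two fibre-type classes `ρ(A) ≥ 1` each side and the graph of the identity). [cite: HulekLaface2019PicardNumbersAV, §2.1 Cor. 2.3] [cite: Arapura2012, §11.2 (PDF p. 177)] -/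
theorem BettiUniverse.three_le_picardNumber_tensor_abelianVariety_self (hHD : exists_isReal_hodgeModel) (hA : IsSmoothProjective A.dim A.X) {d : ℕ} (hAA : IsSmoothProjective d (A.X ⊗ A.X))
    (hg : 1 ≤ A.dim) : 3 ≤ Module.finrank ℚ ↥((BettiUniverse.hodge hHD hAA 2).hodgeClasses 1) := by
  have h := BettiUniverse.two_mul_picardNumber_add_one_le_tensor_abelianVariety_self A hHD hA hAA hg
  have h₁ := BettiUniverse.one_le_finrank_hodgeClasses_hodge_two_abelianVariety A hHD hA hg
  omega

end Picard

end Literature.AlgebraicGeometry.HodgeTheory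

end
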